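import Mathlib
import Summits.PneNP.PneNP.Theorems.OverlapGapAlgebraSolvableImpliesStableSectionMonotoneRepairWeightStep
import Summits.PneNP.PneNP.Theorems.OverlapGapAlgebraSolvableImpliesStableSectionTwoWayRepairTreeCompose

/-!
# PneNP / OverlapGapAlgebra — crux `SolvableImpliesStableSection` (stmt-PneNP-2463):
# the TWO-WAY REPAIR block (3a/·) — tree codes: weight of the recent roots

Support for crux `stmt-PneNP-2463` (`Summit.PneNP.PneNP.Theses.OverlapGapAlgebra.SolvableImpliesStableSection`):
the f-free block "bounded-round two-way repair with one-round memory gives stable sections for every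
`ν > 0` up to `α ≤ 2^k/(4k)`".  Labels carry codes `c = 2·round + τ`; write `U` for the locally valid
codes of `TS d` with a childless root slot (a unique one if the root code is odd) and root round
`< r/2`, and `Rec ⊆ U` for those of root round `r/2 - 1`.  Total weight
(`wt(T) = ∏_e 2^{-k}·(1 | 1/n)`) of the locally valid codes of `TS (d+1)` with root code `r`:

* `sissW_weight_recent` — with a child of round `r/2 - 1` at the root:
  `≤ m·k·2^{-k}·(∑_{Rec} wt/n)·(1 + ∑_U wt/n)^{k-1}` (even roots use only this; the odd roots, the
  round-`0` roots and the base case are in `…TwoWayRepairWeightStepOdd`).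
No definitions (all objects are hypotheses); axioms `propext`, `Classical.choice`, `Quot.sound`.
-/

set_option linter.dupNamespace false -- `Summit.PneNP.PneNP.…`: summit = sub-problem (D-0017)

namespace Summit.PneNP.PneNP.Theorems

open Finset
open scoped Classical

section WeightStep

variable {m k n : ℕ}

/-- **Weight of the codes with a recent child at the root (two-way rule).** Let `U` be the locally
valid codes of `TS d` with a childless root slot, unique if the root code is odd, and root round
`< r/2`, and `Rec` those with root round `r/2 - 1`. The locally valid codes of `TS (d+1)` with root
code `r` and a child of round `r/2 - 1` at the root have total weight at most
`m·k·2^{-k}·(∑_{Rec} wt / n)·(1 + ∑_U wt / n)^{k-1}`. -/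
theorem sissW_weight_recent (asm : Fin m → ℕ → (Fin k → Option (Finset (List (Fin k) × (Fin m × ℕ)))) → Finset (List (Fin k) × (Fin m × ℕ)))
    (hasm : ∀ (c : Fin m) (r : ℕ) (ch : Fin k → Option (Finset (List (Fin k) × (Fin m × ℕ))))
      (e : (List (Fin k) × (Fin m × ℕ))), e ∈ asm c r ch ↔ (e = ([], (c, r)) ∨
      ∃ (j : Fin k) (S : Finset (List (Fin k) × (Fin m × ℕ))), ch j = some S ∧
        ∃ b : List (Fin k), (b, e.2) ∈ S ∧ e.1 = b ++ [j]))
    (TS : ℕ → Finset (Finset (List (Fin k) × (Fin m × ℕ)))) (L : ℕ)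
    (hTS0 : ∀ T : Finset (List (Fin k) × (Fin m × ℕ)), T ∈ TS 0 ↔
      ∃ (c : Fin m) (r : ℕ), r ≤ L ∧ T = asm c r (fun _ => none))
    (hTSs : ∀ (d : ℕ) (T : Finset (List (Fin k) × (Fin m × ℕ))), T ∈ TS (d + 1) ↔
      ∃ (c : Fin m) (r : ℕ), r ≤ L ∧ ∃ ch : Fin k → Option (Finset (List (Fin k) × (Fin m × ℕ))),
        (∀ (j : Fin k) (S : Finset (List (Fin k) × (Fin m × ℕ))), ch j = some S → S ∈ TS d) ∧ T = asm c r ch)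
    (d r : ℕ) :
    ∑ T ∈ (TS (d + 1)).filter (fun T => (((∀ e ∈ T, ∀ (j : Fin k) (y : Fin m) (s : ℕ), (j :: e.1, (y, s)) ∈ T →
        s / 2 < e.2.2 / 2 ∧ ∃ j' : Fin k, ∀ lab : Fin m × ℕ, (j' :: j :: e.1, lab) ∉ T) ∧
      (∀ e ∈ T, ∀ (j : Fin k) (y : Fin m) (s : ℕ), (j :: e.1, (y, s)) ∈ T → s % 2 = 1 →
        ∀ j₁ j₂ : Fin k, (∀ lab : Fin m × ℕ, (j₁ :: j :: e.1, lab) ∉ T) →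
          (∀ lab : Fin m × ℕ, (j₂ :: j :: e.1, lab) ∉ T) → j₁ = j₂) ∧
      (∀ e ∈ T, 1 ≤ e.2.2 / 2 → ∃ (j : Fin k) (y : Fin m) (s : ℕ),
        (j :: e.1, (y, s)) ∈ T ∧ s / 2 + 1 = e.2.2 / 2))) ∧
        (∃ y : Fin m, (([] : List (Fin k)), (y, r)) ∈ T) ∧
        ∃ (j : Fin k) (y : Fin m) (s : ℕ), ([j], (y, s)) ∈ T ∧ s / 2 + 1 = r / 2), (∏ e ∈ T, ((1 / 2 : ℝ) ^ k * (if e.1 = [] then (1 : ℝ) else 1 / (n : ℝ))))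
      ≤ (m : ℝ) * k * (1 / 2 : ℝ) ^ k *
        ((∑ S ∈ (TS d).filter (fun S => (((∀ e ∈ S, ∀ (j : Fin k) (y : Fin m) (s : ℕ), (j :: e.1, (y, s)) ∈ S →
        s / 2 < e.2.2 / 2 ∧ ∃ j' : Fin k, ∀ lab : Fin m × ℕ, (j' :: j :: e.1, lab) ∉ S) ∧
      (∀ e ∈ S, ∀ (j : Fin k) (y : Fin m) (s : ℕ), (j :: e.1, (y, s)) ∈ S → s % 2 = 1 →
        ∀ j₁ j₂ : Fin k, (∀ lab : Fin m × ℕ, (j₁ :: j :: e.1, lab) ∉ S) →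
          (∀ lab : Fin m × ℕ, (j₂ :: j :: e.1, lab) ∉ S) → j₁ = j₂) ∧
      (∀ e ∈ S, 1 ≤ e.2.2 / 2 → ∃ (j : Fin k) (y : Fin m) (s : ℕ),
        (j :: e.1, (y, s)) ∈ S ∧ s / 2 + 1 = e.2.2 / 2))) ∧ (∃ j : Fin k, ∀ lab : Fin m × ℕ, ([j], lab) ∉ S) ∧ ((∀ (y : Fin m) (s : ℕ), (([] : List (Fin k)), (y, s)) ∈ S → s % 2 = 1 →
        ∀ j₁ j₂ : Fin k, (∀ lab : Fin m × ℕ, ([j₁], lab) ∉ S) →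
          (∀ lab : Fin m × ℕ, ([j₂], lab) ∉ S) → j₁ = j₂)) ∧
            ∃ (y : Fin m) (s : ℕ), (([] : List (Fin k)), (y, s)) ∈ S ∧ s / 2 + 1 = r / 2), (∏ e ∈ S, ((1 / 2 : ℝ) ^ k * (if e.1 = [] then (1 : ℝ) else 1 / (n : ℝ))))) / n) *
        (1 + (∑ S ∈ (TS d).filter (fun S => (((∀ e ∈ S, ∀ (j : Fin k) (y : Fin m) (s : ℕ), (j :: e.1, (y, s)) ∈ S →
        s / 2 < e.2.2 / 2 ∧ ∃ j' : Fin k, ∀ lab : Fin m × ℕ, (j' :: j :: e.1, lab) ∉ S) ∧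
      (∀ e ∈ S, ∀ (j : Fin k) (y : Fin m) (s : ℕ), (j :: e.1, (y, s)) ∈ S → s % 2 = 1 →
        ∀ j₁ j₂ : Fin k, (∀ lab : Fin m × ℕ, (j₁ :: j :: e.1, lab) ∉ S) →
          (∀ lab : Fin m × ℕ, (j₂ :: j :: e.1, lab) ∉ S) → j₁ = j₂) ∧
      (∀ e ∈ S, 1 ≤ e.2.2 / 2 → ∃ (j : Fin k) (y : Fin m) (s : ℕ),
        (j :: e.1, (y, s)) ∈ S ∧ s / 2 + 1 = e.2.2 / 2))) ∧ (∃ j : Fin k, ∀ lab : Fin m × ℕ, ([j], lab) ∉ S) ∧ ((∀ (y : Fin m) (s : ℕ), (([] : List (Fin k)), (y, s)) ∈ S → s % 2 = 1 →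
        ∀ j₁ j₂ : Fin k, (∀ lab : Fin m × ℕ, ([j₁], lab) ∉ S) →
          (∀ lab : Fin m × ℕ, ([j₂], lab) ∉ S) → j₁ = j₂)) ∧
            ∃ (y : Fin m) (s : ℕ), (([] : List (Fin k)), (y, s)) ∈ S ∧ s / 2 < r / 2), (∏ e ∈ S, ((1 / 2 : ℝ) ^ k * (if e.1 = [] then (1 : ℝ) else 1 / (n : ℝ))))) / n) ^ (k - 1) := by
  -- the option sets offered to each slot
  set U : Finset (Finset (List (Fin k) × (Fin m × ℕ))) := (TS d).filter (fun S => (((∀ e ∈ S, ∀ (j : Fin k) (y : Fin m) (s : ℕ), (j :: e.1, (y, s)) ∈ S →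
        s / 2 < e.2.2 / 2 ∧ ∃ j' : Fin k, ∀ lab : Fin m × ℕ, (j' :: j :: e.1, lab) ∉ S) ∧
      (∀ e ∈ S, ∀ (j : Fin k) (y : Fin m) (s : ℕ), (j :: e.1, (y, s)) ∈ S → s % 2 = 1 →
        ∀ j₁ j₂ : Fin k, (∀ lab : Fin m × ℕ, (j₁ :: j :: e.1, lab) ∉ S) →
          (∀ lab : Fin m × ℕ, (j₂ :: j :: e.1, lab) ∉ S) → j₁ = j₂) ∧
      (∀ e ∈ S, 1 ≤ e.2.2 / 2 → ∃ (j : Fin k) (y : Fin m) (s : ℕ),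
        (j :: e.1, (y, s)) ∈ S ∧ s / 2 + 1 = e.2.2 / 2))) ∧ (∃ j : Fin k, ∀ lab : Fin m × ℕ, ([j], lab) ∉ S) ∧ ((∀ (y : Fin m) (s : ℕ), (([] : List (Fin k)), (y, s)) ∈ S → s % 2 = 1 →
        ∀ j₁ j₂ : Fin k, (∀ lab : Fin m × ℕ, ([j₁], lab) ∉ S) →
          (∀ lab : Fin m × ℕ, ([j₂], lab) ∉ S) → j₁ = j₂)) ∧
      ∃ (y : Fin m) (s : ℕ), (([] : List (Fin k)), (y, s)) ∈ S ∧ s / 2 < r / 2) with hU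
  set Rec : Finset (Finset (List (Fin k) × (Fin m × ℕ))) := (TS d).filter (fun S => (((∀ e ∈ S, ∀ (j : Fin k) (y : Fin m) (s : ℕ), (j :: e.1, (y, s)) ∈ S →
        s / 2 < e.2.2 / 2 ∧ ∃ j' : Fin k, ∀ lab : Fin m × ℕ, (j' :: j :: e.1, lab) ∉ S) ∧
      (∀ e ∈ S, ∀ (j : Fin k) (y : Fin m) (s : ℕ), (j :: e.1, (y, s)) ∈ S → s % 2 = 1 →
        ∀ j₁ j₂ : Fin k, (∀ lab : Fin m × ℕ, (j₁ :: j :: e.1, lab) ∉ S) →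
          (∀ lab : Fin m × ℕ, (j₂ :: j :: e.1, lab) ∉ S) → j₁ = j₂) ∧
      (∀ e ∈ S, 1 ≤ e.2.2 / 2 → ∃ (j : Fin k) (y : Fin m) (s : ℕ),
        (j :: e.1, (y, s)) ∈ S ∧ s / 2 + 1 = e.2.2 / 2))) ∧ (∃ j : Fin k, ∀ lab : Fin m × ℕ, ([j], lab) ∉ S) ∧ ((∀ (y : Fin m) (s : ℕ), (([] : List (Fin k)), (y, s)) ∈ S → s % 2 = 1 →
        ∀ j₁ j₂ : Fin k, (∀ lab : Fin m × ℕ, ([j₁], lab) ∉ S) →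
          (∀ lab : Fin m × ℕ, ([j₂], lab) ∉ S) → j₁ = j₂)) ∧
      ∃ (y : Fin m) (s : ℕ), (([] : List (Fin k)), (y, s)) ∈ S ∧ s / 2 + 1 = r / 2) with hRec
  set f : Option (Finset (List (Fin k) × (Fin m × ℕ))) → ℝ := fun o => o.elim (1 : ℝ) (fun S => (∏ e ∈ S, ((1 / 2 : ℝ) ^ k * (if e.1 = [] then (1 : ℝ) else 1 / (n : ℝ)))) / n) with hf
  set t : Fin k → Fin k → Finset (Option (Finset (List (Fin k) × (Fin m × ℕ)))) := fun j₀ j =>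
    if j = j₀ then Rec.image some else insertNone U with ht
  -- members of `t j₀ j` are `none` or trees of `TS d`
  have ht_TS : ∀ (j₀ j : Fin k) (S : Finset (List (Fin k) × (Fin m × ℕ))), some S ∈ t j₀ j → S ∈ TS d := by
    intro j₀ j S h
    simp only [ht] at h
    split_ifs at h with hj
    · rw [Finset.mem_image] at h
      obtain ⟨S', hS', hSS⟩ := h
      cases hSS
      exact (Finset.mem_filter.1 hS').1
    · rw [Finset.some_mem_insertNone] at h
      exact (Finset.mem_filter.1 h).1
  -- (1) decomposition of the trees in the class
  have hdecomp : ∀ T ∈ (TS (d + 1)).filter (fun T => (((∀ e ∈ T, ∀ (j : Fin k) (y : Fin m) (s : ℕ), (j :: e.1, (y, s)) ∈ T →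
        s / 2 < e.2.2 / 2 ∧ ∃ j' : Fin k, ∀ lab : Fin m × ℕ, (j' :: j :: e.1, lab) ∉ T) ∧
      (∀ e ∈ T, ∀ (j : Fin k) (y : Fin m) (s : ℕ), (j :: e.1, (y, s)) ∈ T → s % 2 = 1 →
        ∀ j₁ j₂ : Fin k, (∀ lab : Fin m × ℕ, (j₁ :: j :: e.1, lab) ∉ T) →
          (∀ lab : Fin m × ℕ, (j₂ :: j :: e.1, lab) ∉ T) → j₁ = j₂) ∧
      (∀ e ∈ T, 1 ≤ e.2.2 / 2 → ∃ (j : Fin k) (y : Fin m) (s : ℕ),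
        (j :: e.1, (y, s)) ∈ T ∧ s / 2 + 1 = e.2.2 / 2))) ∧
        (∃ y : Fin m, (([] : List (Fin k)), (y, r)) ∈ T) ∧
        ∃ (j : Fin k) (y : Fin m) (s : ℕ), ([j], (y, s)) ∈ T ∧ s / 2 + 1 = r / 2),
      ∃ p ∈ (univ : Finset (Fin m × Fin k)),
        T ∈ (Fintype.piFinset (t p.2)).image (fun ch => asm p.1 r ch) := by
    intro T hT
    rw [Finset.mem_filter] at hT
    obtain ⟨hTS, hloc, ⟨y, hy⟩, j₀, y₀, s₀, hy₀, hs₀⟩ := hT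
    obtain ⟨c, r', _, ch, hch, rfl⟩ := (hTSs d _).1 hTS
    -- the root code is `r`
    have hrr : r' = r := by
      have := (sissR_asm_mem_nil asm hasm c r' ch (y, r)).1 hy
      exact ((Prod.mk.inj this).2).symm
    subst hrr
    -- subtrees have roots
    have hroots : ∀ (j : Fin k) (S : Finset (List (Fin k) × (Fin m × ℕ))), ch j = some S →
        ∃ lab : Fin m × ℕ, (([] : List (Fin k)), lab) ∈ S := by
      intro j S hS
      obtain ⟨⟨c', r'', _, h⟩, _⟩ := sissR_TS_valid asm hasm TS L hTS0 hTSs d S (hch j S hS)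
      exact ⟨(c', r''), h⟩
    obtain ⟨hsub, _⟩ := sissW_locv_asm_imp asm hasm c r' ch hroots hloc
    refine ⟨(c, j₀), mem_univ _, ?_⟩
    rw [Finset.mem_image]
    refine ⟨ch, ?_, rfl⟩
    rw [Fintype.mem_piFinset]
    intro j
    simp only [ht]
    split_ifs with hj
    · -- the recent slot
      subst hj
      obtain ⟨S, hS, hyS⟩ := (sissR_asm_mem_single asm hasm c r' ch j (y₀, s₀)).1 hy₀
      rw [hS, Finset.mem_image]
      refine ⟨S, ?_, rfl⟩
      rw [hRec, Finset.mem_filter]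
      obtain ⟨hl, hn, hu, _⟩ := hsub j S hS
      exact ⟨hch j S hS, hl, hn, hu, y₀, s₀, hyS, hs₀⟩
    · cases hS : ch j with
      | none => exact Finset.none_mem_insertNone
      | some S =>
        rw [Finset.some_mem_insertNone, hU, Finset.mem_filter]
        obtain ⟨hl, hn, hu, hlt⟩ := hsub j S hS
        obtain ⟨lab, hlab⟩ := hroots j S hS
        exact ⟨hch j S hS, hl, hn, hu, lab.1, lab.2, hlab, hlt lab.1 lab.2 hlab⟩
  -- (2) cover, (3) sum over the image ≤ sum over the assembling data
  refine (sissR_sum_cover_le _ _ _ _ sissR_wt_nonneg hdecomp).trans ?_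
  have hinner : ∀ p : Fin m × Fin k,
      ∑ T ∈ (Fintype.piFinset (t p.2)).image (fun ch => asm p.1 r ch), (∏ e ∈ T, ((1 / 2 : ℝ) ^ k * (if e.1 = [] then (1 : ℝ) else 1 / (n : ℝ))))
        ≤ (1 / 2 : ℝ) ^ k * (((∑ S ∈ Rec, (∏ e ∈ S, ((1 / 2 : ℝ) ^ k * (if e.1 = [] then (1 : ℝ) else 1 / (n : ℝ))))) / n) *
            (1 + (∑ S ∈ U, (∏ e ∈ S, ((1 / 2 : ℝ) ^ k * (if e.1 = [] then (1 : ℝ) else 1 / (n : ℝ))))) / n) ^ (k - 1)) := by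
    rintro ⟨c, j₀⟩
    refine (Finset.sum_image_le_of_nonneg fun T _ => sissR_wt_nonneg T).trans ?_
    -- (4) the weight of each assembled code
    have hw : ∀ ch ∈ Fintype.piFinset (t j₀),
        (∏ e ∈ asm c r ch, ((1 / 2 : ℝ) ^ k * (if e.1 = [] then (1 : ℝ) else 1 / (n : ℝ)))) = (1 / 2 : ℝ) ^ k * ∏ j : Fin k, f (ch j) := by
      intro ch hch
      rw [Fintype.mem_piFinset] at hch
      refine sissR_wt_asm asm hasm c r ch fun j S hS => ?_
      exact sissR_TS_rootCount asm hasm TS L hTS0 hTSs d S (ht_TS j₀ j S (by rw [← hS]; exact hch j))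
    rw [Finset.sum_congr rfl hw, ← Finset.mul_sum, ← Finset.prod_univ_sum]
    refine mul_le_mul_of_nonneg_left (le_of_eq ?_) (pow_nonneg (by norm_num) _)
    -- (5) the product over the slots
    have hX : ∑ o ∈ insertNone U, f o = 1 + (∑ S ∈ U, (∏ e ∈ S, ((1 / 2 : ℝ) ^ k * (if e.1 = [] then (1 : ℝ) else 1 / (n : ℝ))))) / n := by
      rw [Finset.sum_insertNone]
      simp only [hf, Option.elim_none, Option.elim_some]
      rw [Finset.sum_div]
    have hA : ∑ o ∈ Rec.image some, f o = (∑ S ∈ Rec, (∏ e ∈ S, ((1 / 2 : ℝ) ^ k * (if e.1 = [] then (1 : ℝ) else 1 / (n : ℝ))))) / n := by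
      rw [Finset.sum_image (fun S _ S' _ h => Option.some_injective _ h)]
      simp only [hf, Option.elim_some]
      rw [Finset.sum_div]
    rw [← Finset.mul_prod_erase (univ : Finset (Fin k)) _ (mem_univ j₀)]
    simp only [ht, if_pos rfl]
    rw [hA]
    congr 1
    rw [Finset.prod_congr rfl (fun j hj => by rw [if_neg (Finset.ne_of_mem_erase hj)]), Finset.prod_const,
      Finset.card_erase_of_mem (mem_univ j₀), Finset.card_univ, Fintype.card_fin, hX]
  refine (Finset.sum_le_sum fun p _ => hinner p).trans ?_
  rw [Finset.sum_const, Finset.card_univ, Fintype.card_prod, Fintype.card_fin, Fintype.card_fin,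
    nsmul_eq_mul]
  push_cast
  exact le_of_eq (by ring)

end WeightStep

end Summit.PneNP.PneNP.Theorems
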